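import Summits.Ventures.PercRepro.SixFourResidueTwoPointsD

/-!
# The `t = 3` clause of `SixFourResidue` — plane + one point (Proposition 21.5 at `t = 3`, `g ≤ 8`)

`G = τ ∪ {a}` with `τ = P₀ ∩ G` a plane trace of `g − 1` points and `a ∉ P₀`.  Every rank-`4` subset of `G` is
`B″ ∪ {a}` with `B″ ∈ R₃(τ)`, and `G ∖ (B″ ∪ {a}) = τ ∖ B″`.  At `t = 3` the term of `B″ ∪ {a}` in
`J₃(G) = Σ_{B ∈ R₄(G)} 3·w_∞(B) − (6/5)·[r(G ∖ B) = 3]` is at least `3/(2 + k(B″)) − (6/5)·[r(τ ∖ B″) = 3]`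
(`jterm3_insert_a_ge`, `J_three_ge_shares`); `k(B″) = 3` for the triples and `≤ 1` for the larger sets.  The shares sum to
`≥ (3/5)·T + (3/2)·D₃ − (1/2)·LP` (`share3_sum_ge`) and the demands to `≤ #{B″ : |B″| + 3 ≤ p}` (`dem3_sum_le`), so
`0 ≤ J₃(G)` follows from the profile inequality `12·Small ≤ 6·T + 15·D₃ − 5·LP` on the `44` admissible pairwise-OK line
profiles with `p ≤ 7` (`profCheck3_holds`, minimum slack `6`, exact `Δ(τ)` minima `14/5, 43/5, 96/5, 147/5` for
`P = 4, …, 7`).  The mirror of `SixFourResidueTwoPointsA–D` for one point off the plane at `t = 3`: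
`J_three_nonneg_of_plane_add_one : (P₀ ∩ G).card + 1 = G.card → G.card ≤ 8 → 0 ≤ J M G 3`.
-/

namespace PercRepro.SixFour

/-! ## The profile side -/

/-- The profile inequality of Proposition 21.5 at `t = 3` (scaled by `10`): `12·#{|B″| ≤ p − 3} ≤ 6·T + 15·D₃ − 5·LP`. -/
def ProfIneq3 (p i3 i4 i5 i6 : ℕ) : Prop :=
  12 * SmallProf p i3 i4 i5 i6 ≤ 6 * TProf p i3 i4 i5 i6 + 15 * (D3Prof p i4 i5 i6 : ℤ) - 5 * LPProf p i3 i4 i5 i6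

/-- `ProfIneq3` is decidable. -/
instance (p i3 i4 i5 i6 : ℕ) : Decidable (ProfIneq3 p i3 i4 i5 i6) := by unfold ProfIneq3; infer_instance

/-- The finite check: every admissible, pairwise-OK profile with `p ≤ 7` satisfies the `t = 3` inequality. -/
def profCheck3 : Prop := ∀ p < 8, ∀ i3 < 8, ∀ i4 < 4, ∀ i5 < 3, ∀ i6 < 2,
  (!decide (ProfileOK p (p.choose 2 - (3 * i3 + 6 * i4 + 10 * i5 + 15 * i6)) i3 i4 i5 i6 ∧ PairOK p i3 i4 i5 i6) ||
    decide (ProfIneq3 p i3 i4 i5 i6)) = true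

/-- The finite check holds (`44` profiles, minimum slack `6`). -/
theorem profCheck3_holds : profCheck3 := by
  unfold profCheck3
  decide

/-- **The `t = 3` profile inequality** for every admissible, pairwise-OK profile with `p ≤ 7`. -/
theorem profIneq3_of_profileOK {p i2 i3 i4 i5 i6 : ℕ} (hp : p ≤ 7) (h3 : i3 < 8) (h4 : i4 < 4) (h5 : i5 < 3)
    (h6 : i6 < 2) (hok : ProfileOK p i2 i3 i4 i5 i6) (hpair : PairOK p i3 i4 i5 i6) : ProfIneq3 p i3 i4 i5 i6 := by
  have hi2 : i2 = p.choose 2 - (3 * i3 + 6 * i4 + 10 * i5 + 15 * i6) := by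
    have := hok.1
    omega
  subst hi2
  have h := profCheck3_holds p (by omega) i3 h3 i4 h4 i5 h5 i6 h6
  rw [Bool.or_eq_true, Bool.not_eq_true', decide_eq_false_iff_not, decide_eq_true_eq] at h
  exact h.resolve_left (not_not.2 ⟨hok, hpair⟩)

/-! ## The matroid side -/

open Finset ThmH

variable {α : Type*} [DecidableEq α] {M : Matroid α} [M.Finite] {G : Finset α}

/-- The term of `B` in `J₃(G)`: `f₃(B) = 3·w_∞(B) − (6/5)·[¬ (r(G ∖ B) + 1 ≤ 3)]`. -/
noncomputable def jterm3 (M : Matroid α) [M.Finite] (G B : Finset α) : ℚ :=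
  3 * wInf M B - 6 / 5 * (if M.eRk ((G \ B : Finset α) : Set α) + 1 ≤ (3 : ℕ∞) then 0 else 1)

/-- `J₃ = Σ_{B ∈ R₄} f₃(B)`. -/
theorem J_three_eq_sum_jterm3 : J M G 3 = ∑ B ∈ R4 M G, jterm3 M G B := by
  have hind : ∑ B ∈ R4 M G, (if M.eRk ((G \ B : Finset α) : Set α) + 1 ≤ (3 : ℕ∞) then (0 : ℚ) else 1) =
      (N4 M G : ℚ) - (DF M G 3 : ℚ) := by
    unfold N4 DF
    rw [← Finset.card_filter_add_card_filter_not (s := R4 M G)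
      (fun B : Finset α => M.eRk ((G \ B : Finset α) : Set α) + 1 ≤ (3 : ℕ∞))]
    rw [Finset.sum_ite, Finset.sum_const_zero, Finset.sum_const, zero_add, nsmul_eq_mul, mul_one]
    push_cast
    ring
  unfold J jterm3
  rw [Finset.sum_sub_distrib, ← Finset.mul_sum]
  have h3 : ∑ x ∈ R4 M G, 3 * wInf M x = 3 * ∑ x ∈ R4 M G, wInf M x := (Finset.mul_sum _ _ _).symm
  have h2 : ∑ x ∈ R4 M G, 6 / 5 * (if M.eRk ((G \ x : Finset α) : Set α) + 1 ≤ (3 : ℕ∞) then (0 : ℚ) else 1) =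
      6 / 5 * ∑ x ∈ R4 M G, (if M.eRk ((G \ x : Finset α) : Set α) + 1 ≤ (3 : ℕ∞) then (0 : ℚ) else 1) :=
    (Finset.mul_sum _ _ _).symm
  rw [h2, h3, hind]
  push_cast
  ring

/-- The share of `B″` at `t = 3`: `3/(2 + k(B″))`. -/
noncomputable def share3 (M : Matroid α) [M.Finite] (S : Finset α) : ℚ := 3 / (2 + (kcol M S : ℚ))

/-- The demand indicator of `B″` at `t = 3`: `1` when `r(τ ∖ B″) = 3` (i.e. `¬ (r(τ ∖ B″) + 1 ≤ 3)`). -/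
noncomputable def dem3 (M : Matroid α) [M.Finite] (τ B : Finset α) : ℚ :=
  if M.eRk ((τ \ B : Finset α) : Set α) + 1 ≤ (3 : ℕ∞) then 0 else 1

section PlaneOne

variable {P₀ : Finset α} {a : α}

/-- The point off the plane: `G ∖ P₀ = {a}`. -/
structure OneOff (M : Matroid α) [M.Finite] (G P₀ : Finset α) (a : α) : Prop where
  /-- `a ∈ G` -/
  aG : a ∈ G
  /-- `a ∉ P₀` -/
  aP : a ∉ P₀
  /-- every point of `G` off `P₀` is `a` -/
  cover : ∀ z ∈ G, z ∉ P₀ → z = a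

/-- A plane trace of `g − 1` points leaves exactly one point off the plane. -/
theorem oneOff_of_card (hcard : (P₀ ∩ G).card + 1 = G.card) : ∃ a : α, OneOff M G P₀ a := by
  have h1 : (G \ P₀).card = 1 := by
    have := Finset.card_sdiff_add_card_inter G P₀
    rw [Finset.inter_comm] at this
    omega
  obtain ⟨a, hab⟩ := Finset.card_eq_one.1 h1
  have ha : a ∈ G \ P₀ := by rw [hab]; exact Finset.mem_singleton_self _
  rw [Finset.mem_sdiff] at ha
  refine ⟨a, ⟨ha.1, ha.2, fun z hz hzP => ?_⟩⟩
  have : z ∈ G \ P₀ := Finset.mem_sdiff.2 ⟨hz, hzP⟩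
  rw [hab, Finset.mem_singleton] at this
  exact this

variable (ht : OneOff M G P₀ a)
include ht

/-- `G ∖ (B″ ∪ {a}) = τ ∖ B″`. -/
theorem sdiff_insert_eq₁ (B : Finset α) : G \ insert a B = (P₀ ∩ G) \ B := by
  ext z
  rw [Finset.mem_sdiff, Finset.mem_insert, Finset.mem_sdiff, Finset.mem_inter]
  constructor
  · rintro ⟨hzG, hz⟩
    push Not at hz
    by_cases hzP : z ∈ P₀
    · exact ⟨⟨hzP, hzG⟩, hz.2⟩
    · exact absurd (ht.cover z hzG hzP) hz.1
  · rintro ⟨⟨hzP, hzG⟩, hzB⟩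
    refine ⟨hzG, ?_⟩
    push Not
    exact ⟨fun h => ht.aP (h ▸ hzP), hzB⟩

/-- A subset of `G` avoiding `a` lies in `τ`. -/
theorem subset_τ_of_notMem₁ {B : Finset α} (hB : B ⊆ G) (ha : a ∉ B) : B ⊆ P₀ ∩ G := by
  intro b hb
  refine Finset.mem_inter.2 ⟨?_, hB hb⟩
  by_contra hbP
  exact ha ((ht.cover b (hB hb) hbP) ▸ hb)

variable (hG : G ⊆ gr M) (hP₀ : P₀ ∈ planes M)
include hG hP₀

/-- `B″ ∪ {a} ∈ R₄(G)`. -/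
theorem insert_a_mem_R4₁ {B : Finset α} (hB : B ∈ R3 M (P₀ ∩ G)) : insert a B ∈ R4 M G := by
  obtain ⟨hBτ, hB3⟩ := mem_R3.1 hB
  rw [mem_R4]
  refine ⟨Finset.insert_subset ht.aG (hBτ.trans Finset.inter_subset_right), ?_⟩
  rw [eRk_insert_of_notMem_plane hP₀ (hBτ.trans Finset.inter_subset_left) (hG ht.aG) ht.aP, hB3]
  rfl

/-- **`R₄(G) = {B″ ∪ {a} : B″ ∈ R₃(τ)}`**: a rank-`4` subset of `G` contains `a` (else it lies in the plane) and its rest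
in `τ` has rank `3`. -/
theorem R4_eq_image₁ : R4 M G = (R3 M (P₀ ∩ G)).image (fun B : Finset α => insert a B) := by
  ext B
  rw [Finset.mem_image]
  constructor
  · intro hB
    obtain ⟨hBG, hB4⟩ := mem_R4.1 hB
    have haB : a ∈ B := by
      by_contra haB
      have hBτ := subset_τ_of_notMem₁ ht hBG haB
      have h3 : M.eRk (B : Set α) ≤ 3 := by
        rw [← (mem_planes.1 hP₀).2.2]
        exact M.eRk_mono (Finset.coe_subset.2 (hBτ.trans Finset.inter_subset_left))
      rw [hB4] at h3
      exact absurd h3 (by decide)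
    have hEτ : B.erase a ⊆ P₀ ∩ G :=
      subset_τ_of_notMem₁ ht ((Finset.erase_subset a B).trans hBG) (Finset.notMem_erase a B)
    refine ⟨B.erase a, ?_, Finset.insert_erase haB⟩
    rw [mem_R3]
    refine ⟨hEτ, ?_⟩
    apply eRk_eq_three_of_add_one
    rw [← eRk_insert_of_notMem_plane hP₀ (hEτ.trans Finset.inter_subset_left) (hG ht.aG) ht.aP,
      Finset.insert_erase haB, hB4]
  · rintro ⟨B'', hB'', rfl⟩
    exact insert_a_mem_R4₁ ht hG hP₀ hB''

omit hG in
/-- `f₃(B″ ∪ {a}) ≥ 3/(2 + k(B″)) − (6/5)·dem₃(B″)`. -/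
theorem jterm3_insert_a_ge {B : Finset α} (hB : B ∈ R3 M (P₀ ∩ G)) :
    share3 M B - 6 / 5 * dem3 M (P₀ ∩ G) B ≤ jterm3 M G (insert a B) := by
  obtain ⟨hBτ, -⟩ := mem_R3.1 hB
  have hw := wInf_insert_ge hP₀ (hBτ.trans Finset.inter_subset_left) (x := a) ht.aP
  have h3 : share3 M B = 3 * (1 / (2 + (kcol M B : ℚ))) := by unfold share3; ring
  unfold jterm3 dem3
  rw [sdiff_insert_eq₁ ht B, h3]
  split_ifs <;> linarith

/-- **The regrouped sum**: `Σ_{B″ ∈ R₃(τ)} share₃(B″) − (6/5)·Σ_{B″} dem₃(B″) ≤ J₃(G)`. -/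
theorem J_three_ge_shares :
    ∑ B ∈ R3 M (P₀ ∩ G), share3 M B - 6 / 5 * ∑ B ∈ R3 M (P₀ ∩ G), dem3 M (P₀ ∩ G) B ≤ J M G 3 := by
  rw [J_three_eq_sum_jterm3, R4_eq_image₁ ht hG hP₀, Finset.sum_image (insert_injOn a ht.aP), Finset.mul_sum,
    ← Finset.sum_sub_distrib]
  exact Finset.sum_le_sum (fun B hB => jterm3_insert_a_ge ht hP₀ hB)

end PlaneOne

section Counts

variable (hs : Simple M) {τ : Finset α} (hτ : τ ⊆ gr M)
include hs hτ

omit hs hτ in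
/-- A triple has share `3/5`. -/
theorem share3_eq_of_card_three {S : Finset α} (hc : S.card = 3) : share3 M S = 3 / 5 := by
  unfold share3
  rw [kcol_eq_three_of_card_three hc]
  norm_num

/-- A rank-`3` set with `≥ 4` points has share `≥ 1`, and `≥ 3/2` unless it is a line plus a point. -/
theorem share3_ge_of_four_le {S : Finset α} (hS : S ⊆ τ) (hr3 : M.eRk (S : Set α) = 3) (hc : 4 ≤ S.card) :
    (if kcol M S = 1 then (1 : ℚ) else 3 / 2) ≤ share3 M S := by
  have hk := kcol_le_one_of_four_le hs hτ hS hr3 hc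
  unfold share3
  split_ifs with h1
  · rw [h1]; norm_num
  · have h0 : kcol M S = 0 := by omega
    rw [h0]; norm_num

/-- **The share sum at `t = 3`**: `(3/5)·T + (3/2)·D₃ − (1/2)·LP ≤ Σ_{S ∈ R₃(τ)} share₃(S)`. -/
theorem share3_sum_ge : (3 / 5 : ℚ) * Tcnt M τ + 3 / 2 * D3cnt M τ - 1 / 2 * LPcnt M τ ≤ ∑ S ∈ R3 M τ, share3 M S := by
  have hpt : ∀ S ∈ R3 M τ, (if S.card = 3 then (3 / 5 : ℚ) else if 4 ≤ S.card ∧ kcol M S = 1 then 1 else 3 / 2)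
      ≤ share3 M S := by
    intro S hS
    obtain ⟨hSτ, hr3⟩ := mem_R3.1 hS
    have h3 : 3 ≤ S.card := three_le_card_of_eRk_eq_three hr3
    split_ifs with hc h41
    · exact (share3_eq_of_card_three hc).ge
    · have := share3_ge_of_four_le hs hτ hSτ hr3 h41.1
      rw [if_pos h41.2] at this
      exact this
    · have := share3_ge_of_four_le hs hτ hSτ hr3 (by omega)
      rw [if_neg (fun h => h41 ⟨by omega, h⟩)] at this
      exact this
  refine le_trans ?_ (Finset.sum_le_sum hpt)
  rw [Finset.sum_ite, Finset.sum_const, Finset.sum_ite, Finset.sum_const, Finset.sum_const, nsmul_eq_mul, nsmul_eq_mul,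
    nsmul_eq_mul]
  unfold Tcnt D3cnt LPcnt
  have hA : ((R3 M τ).filter (fun S => ¬ S.card = 3)).filter (fun S => 4 ≤ S.card ∧ kcol M S = 1) =
      (R3 M τ).filter (fun S => 4 ≤ S.card ∧ kcol M S = 1) := by
    rw [Finset.filter_filter]
    refine Finset.filter_congr (fun S hS => ?_)
    constructor
    · exact fun h => h.2
    · exact fun h => ⟨by omega, h⟩
  have hB : ((R3 M τ).filter (fun S => ¬ S.card = 3)).filter (fun S => ¬ (4 ≤ S.card ∧ kcol M S = 1)) =
      ((R3 M τ).filter (fun S => 4 ≤ S.card)).filter (fun S => ¬ (kcol M S = 1)) := by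
    rw [Finset.filter_filter, Finset.filter_filter]
    refine Finset.filter_congr (fun S hS => ?_)
    have h3 : 3 ≤ S.card := three_le_card_of_eRk_eq_three (mem_R3.1 hS).2
    constructor
    · rintro ⟨hne, hn⟩
      refine ⟨by omega, fun h1 => hn ⟨by omega, h1⟩⟩
    · rintro ⟨h4, hn⟩
      exact ⟨by omega, fun h => hn h.2⟩
  rw [hA, hB]
  have hsplit := Finset.card_filter_add_card_filter_not (s := (R3 M τ).filter (fun S => 4 ≤ S.card))
    (fun S : Finset α => kcol M S = 1)
  rw [Finset.filter_filter] at hsplit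
  have hsplit' : ((R3 M τ).filter (fun S => 4 ≤ S.card ∧ kcol M S = 1)).card +
      (((R3 M τ).filter (fun S => 4 ≤ S.card)).filter (fun S => ¬ kcol M S = 1)).card =
      ((R3 M τ).filter (fun S => 4 ≤ S.card)).card := by
    rw [← hsplit, Finset.filter_filter]
  have hq : ((((R3 M τ).filter (fun S => 4 ≤ S.card)).filter (fun S => ¬ kcol M S = 1)).card : ℚ) =
      ((R3 M τ).filter (fun S => 4 ≤ S.card)).card - ((R3 M τ).filter (fun S => 4 ≤ S.card ∧ kcol M S = 1)).card := by
    rw [← hsplit']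
    push_cast
    ring
  rw [hq]
  ring_nf
  linarith

omit hs hτ in
/-- **The demand count at `t = 3`**: `Σ_{S ∈ R₃(τ)} dem₃(S) ≤ #{S ∈ R₃(τ) : |S| + 3 ≤ p}` (a rest of `≤ 2` points has
rank `≤ 2`). -/
theorem dem3_sum_le :
    ∑ S ∈ R3 M τ, dem3 M τ S ≤ ((R3 M τ).filter (fun S => S.card + 3 ≤ τ.card)).card := by
  have hpt : ∀ S ∈ R3 M τ, dem3 M τ S ≤ (if S.card + 3 ≤ τ.card then (1 : ℚ) else 0) := by
    intro S hS
    obtain ⟨hSτ, -⟩ := mem_R3.1 hS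
    unfold dem3
    split_ifs with h1 h2 h2
    · norm_num
    · norm_num
    · norm_num
    · exfalso
      apply h1
      have hle := M.eRk_le_encard ((τ \ S : Finset α) : Set α)
      rw [Set.encard_coe_eq_coe_finsetCard, Finset.card_sdiff_of_subset hSτ] at hle
      have hc : τ.card - S.card ≤ 2 := by omega
      calc M.eRk ((τ \ S : Finset α) : Set α) + 1 ≤ ((τ.card - S.card : ℕ) : ℕ∞) + 1 := add_le_add_left hle 1
        _ ≤ ((2 : ℕ) : ℕ∞) + 1 := add_le_add_left (by exact_mod_cast hc) 1
        _ = 3 := by norm_num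
  refine (Finset.sum_le_sum hpt).trans ?_
  rw [Finset.sum_ite, Finset.sum_const, Finset.sum_const_zero, add_zero, nsmul_eq_mul, mul_one]

/-- **The demanded sets are small**: `#{S ∈ R₃(τ) : |S| + 3 ≤ p} ≤ SmallProf` for a rank-`3` trace with `p ≤ 7`. -/
theorem card_small_le_SmallProf (hr3 : M.eRk (τ : Set α) = 3) (h7 : τ.card ≤ 7) :
    ((((R3 M τ).filter (fun S => S.card + 3 ≤ τ.card)).card : ℕ) : ℤ) ≤
      SmallProf τ.card (inc M τ 3) (inc M τ 4) (inc M τ 5) (inc M τ 6) := by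
  unfold SmallProf
  rw [← Tcnt_eq hs hτ hr3 h7, ← card_four_eq hs hτ hr3 h7]
  have hsub : (R3 M τ).filter (fun S => S.card + 3 ≤ τ.card) ⊆
      ((R3 M τ).filter (fun S => S.card = 3 ∧ 6 ≤ τ.card)) ∪ ((R3 M τ).filter (fun S => S.card = 4 ∧ 7 ≤ τ.card)) := by
    intro S hS
    rw [Finset.mem_filter] at hS
    rw [Finset.mem_union, Finset.mem_filter, Finset.mem_filter]
    have h3 : 3 ≤ S.card := three_le_card_of_eRk_eq_three (mem_R3.1 hS.1).2
    rcases (show S.card = 3 ∨ S.card = 4 by omega) with h | h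
    · exact Or.inl ⟨hS.1, h, by omega⟩
    · exact Or.inr ⟨hS.1, h, by omega⟩
  have h1 : ((R3 M τ).filter (fun S => S.card = 3 ∧ 6 ≤ τ.card)).card = if 6 ≤ τ.card then Tcnt M τ else 0 := by
    split_ifs with h6
    · unfold Tcnt
      congr 1
      exact Finset.filter_congr (fun S _ => by simp [h6])
    · rw [Finset.card_eq_zero, Finset.filter_eq_empty_iff]
      intro S _ h
      exact h6 h.2
  have h2 : ((R3 M τ).filter (fun S => S.card = 4 ∧ 7 ≤ τ.card)).card =
      if 7 ≤ τ.card then ((R3 M τ).filter (fun S => S.card = 4)).card else 0 := by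
    split_ifs with h7'
    · congr 1
      exact Finset.filter_congr (fun S _ => by simp [h7'])
    · rw [Finset.card_eq_zero, Finset.filter_eq_empty_iff]
      intro S _ h
      exact h7' h.2
  have hle : ((R3 M τ).filter (fun S => S.card + 3 ≤ τ.card)).card ≤
      ((R3 M τ).filter (fun S => S.card = 3 ∧ 6 ≤ τ.card)).card +
        ((R3 M τ).filter (fun S => S.card = 4 ∧ 7 ≤ τ.card)).card :=
    (Finset.card_le_card hsub).trans (Finset.card_union_le _ _)
  rw [h1, h2] at hle
  have hz := (Nat.cast_le (α := ℤ)).2 hle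
  push_cast at hz
  split_ifs at hz ⊢ <;> linarith

end Counts

section Final

variable (hs : Simple M) (hG : G ⊆ gr M) {P₀ : Finset α} (hP₀ : P₀ ∈ planes M)
include hs hG hP₀

/-- **Proposition 21.5 at `t = 3`, `g ≤ 8` (§21.18.3 (β), `k = 1`)**: if some plane trace has `g − 1` points,
`0 ≤ J₃(G)`. -/
theorem J_three_nonneg_of_plane_add_one (hcard : (P₀ ∩ G).card + 1 = G.card) (hg : G.card ≤ 8) : 0 ≤ J M G 3 := by
  obtain ⟨a, ht⟩ := oneOff_of_card (M := M) hcard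
  have hτ : P₀ ∩ G ⊆ gr M := Finset.inter_subset_right.trans hG
  have hshares := J_three_ge_shares ht hG hP₀
  by_cases hr3 : M.eRk ((P₀ ∩ G : Finset α) : Set α) = 3
  · set τ := P₀ ∩ G with hτdef
    have h7 : τ.card ≤ 7 := by omega
    have hsum := share3_sum_ge hs hτ
    have hdem := dem3_sum_le (M := M) (τ := τ)
    have hsmall := card_small_le_SmallProf hs hτ hr3 h7
    obtain ⟨hb3, hb4, hb5, hb6⟩ := inc_bounds_of_trace hs hτ h7
    have hok := profileOK_of_trace hs hτ hr3 h7
    have hpair := pairOK_of_trace hs (τ := τ)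
    have hineq := profIneq3_of_profileOK h7 hb3 hb4 hb5 hb6 hok hpair
    unfold ProfIneq3 at hineq
    have hT := Tcnt_eq hs hτ hr3 h7
    have hD : ((D3cnt M τ : ℕ) : ℤ) = (D3Prof τ.card (inc M τ 4) (inc M τ 5) (inc M τ 6) : ℤ) := by
      exact_mod_cast D3cnt_eq hs hτ hr3 h7
    have hLP := LPcnt_le hs hτ hr3 h7
    have hZ : 12 * ((((R3 M τ).filter (fun S => S.card + 3 ≤ τ.card)).card : ℕ) : ℤ) ≤
        6 * (Tcnt M τ : ℤ) + 15 * (D3cnt M τ : ℤ) - 5 * (LPcnt M τ : ℤ) := by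
      rw [hT, hD]
      linarith
    have hQ : (12 : ℚ) * (((R3 M τ).filter (fun S => S.card + 3 ≤ τ.card)).card : ℚ) ≤
        6 * (Tcnt M τ : ℚ) + 15 * (D3cnt M τ : ℚ) - 5 * (LPcnt M τ : ℚ) := by
      exact_mod_cast hZ
    linarith
  · have hempty : R3 M (P₀ ∩ G) = ∅ := by
      rw [Finset.eq_empty_iff_forall_notMem]
      intro S hS
      obtain ⟨hSτ, hS3⟩ := mem_R3.1 hS
      apply hr3
      refine le_antisymm ?_ (by rw [← hS3]; exact M.eRk_mono (Finset.coe_subset.2 hSτ))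
      rw [← (mem_planes.1 hP₀).2.2]
      exact M.eRk_mono (Finset.coe_subset.2 Finset.inter_subset_left)
    rw [hempty, Finset.sum_empty, Finset.sum_empty] at hshares
    linarith

end Final

end PercRepro.SixFour
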